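import Mathlib.Analysis.ODE.Gronwall
import Mathlib.Analysis.SpecialFunctions.Exponential
import HarnessLib

/-!
# Route DopplerClock (AnomalousDissipation) — support item `LongitudinalClassQuiet`
# (stmt-AnomalousDissipation-18134), real-variable toolkit: asymptotics of a damped rotation ODE

Elementary long-time behaviour of scalar differential inequalities and of the forced, damped
planar rotation system that governs the two streak amplitudes of an `x₀`-invariant flow driven by
the swept Doppler pair (see `DopplerClockLongitudinalClassQuiet`):

* `tendsto_zero_of_deriv_le_neg_mul_add` — if `W ≥ 0` is differentiable within `[T₀, ∞)` with
  `W' ≤ -a W + g`, `a > 0`, `g → 0`, then `W → 0` (linear Grönwall bound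
  `Mathlib.le_gronwallBound_of_liminf_deriv_right_le` on `[T, ∞)` with `|g| ≤ aε/2`, then `T → ∞`);
* `tendsto_of_damped_rotation` — if `A' = e₁ - aA - ωB + c`, `B' = e₂ + ωA - aB` on `[T₀, ∞)` with
  `a > 0` and `e₁, e₂ → 0`, then `A → c a /(a² + ω²)` and `B → c ω /(a² + ω²)` (the Lyapunov function
  `(A - A_∞)² + (B - B_∞)²` satisfies the previous differential inequality).

Pure real analysis over Mathlib; no fluid notions. Supports stmt-AnomalousDissipation-18134.
-/

noncomputable section

-- `Summit.<Summit>.<Problem>` is the tree's mandated summit-side namespace (CONVENTIONS §2); for this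
-- single-conjunct summit the two coincide, so the duplicate is deliberate.
set_option linter.dupNamespace false

open Set Filter Topology

namespace Summit.AnomalousDissipation.AnomalousDissipation.Theorems

namespace LongitudinalQuiet

/-- **Linear differential inequality with vanishing forcing.** Let `W ≥ 0` on `[T₀, ∞)` have
one-sided derivative `W'` within `[T₀, ∞)` at every `t ≥ T₀`, with `W' t ≤ -a W t + g t`, `a > 0`,
and `g t → 0` as `t → ∞`. Then `W t → 0` (Grönwall: on `[T, ∞)` where `g ≤ aε/2`,
`W t ≤ W T e^{-a(t-T)} + ε/2`). [folklore] -/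
theorem tendsto_zero_of_deriv_le_neg_mul_add {W W' g : ℝ → ℝ} {a T₀ : ℝ} (ha : 0 < a)
    (hderiv : ∀ t, T₀ ≤ t → HasDerivWithinAt W (W' t) (Ici T₀) t)
    (hbound : ∀ t, T₀ ≤ t → W' t ≤ -a * W t + g t)
    (hW : ∀ t, T₀ ≤ t → 0 ≤ W t) (hg : Tendsto g atTop (𝓝 0)) :
    Tendsto W atTop (𝓝 0) := by
  rw [Metric.tendsto_atTop]
  intro ε hε
  -- `|g| ≤ aε/2` from some time `T₁` on
  have haε : 0 < a * ε / 2 := by positivity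
  obtain ⟨T₁, hT₁⟩ := Metric.tendsto_atTop.1 hg (a * ε / 2) haε
  set T := max T₀ T₁ with hT
  have hTT₀ : T₀ ≤ T := le_max_left _ _
  have hcont : ContinuousOn W (Ici T₀) := fun t ht => (hderiv t ht).continuousWithinAt
  -- Grönwall on `[T, b]` for every `b`
  have hgron : ∀ b t, t ∈ Icc T b →
      W t ≤ gronwallBound (W T) (-a) (a * ε / 2) (t - T) := by
    intro b t ht
    refine le_gronwallBound_of_liminf_deriv_right_le (f' := W') ?_ ?_ le_rfl ?_ t ht
    · exact hcont.mono fun s hs => le_trans hTT₀ hs.1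
    · intro x hx r hr
      have hx₀ : T₀ ≤ x := hTT₀.trans hx.1
      have hd : HasDerivWithinAt W (W' x) (Ici x) x :=
        (hderiv x hx₀).mono (Ici_subset_Ici.2 hx₀)
      have h := hd.liminf_right_slope_le hr
      refine h.mono fun z hz => ?_
      simpa only [slope, vsub_eq_sub, smul_eq_mul] using hz
    · intro x hx
      have hx₀ : T₀ ≤ x := hTT₀.trans hx.1
      have hx₁ : T₁ ≤ x := (le_max_right _ _).trans hx.1
      have hgx : g x ≤ a * ε / 2 := by
        have := hT₁ x hx₁
        rw [Real.dist_eq, sub_zero] at this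
        exact (le_abs_self _).trans this.le
      calc W' x ≤ -a * W x + g x := hbound x hx₀
        _ ≤ -a * W x + a * ε / 2 := by linarith
  -- the Grönwall bound is `W T e^{-a s} + ε/2 (1 - e^{-a s}) ≤ W T e^{-a s} + ε/2`
  have hgb : ∀ s, 0 ≤ s → gronwallBound (W T) (-a) (a * ε / 2) s ≤
      W T * Real.exp (-a * s) + ε / 2 := by
    intro s hs
    rw [gronwallBound_of_K_ne_0 (neg_ne_zero.2 ha.ne')]
    have h1 : Real.exp (-a * s) ≤ 1 := by
      rw [Real.exp_le_one_iff]
      nlinarith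
    have h2 : 0 < Real.exp (-a * s) := Real.exp_pos _
    have h3 : a * ε / 2 / -a * (Real.exp (-a * s) - 1) = ε / 2 * (1 - Real.exp (-a * s)) := by
      field_simp
      ring
    show W T * Real.exp (-a * s) + a * ε / 2 / -a * (Real.exp (-a * s) - 1) ≤ _
    rw [h3]
    nlinarith
  -- choose `T₂ ≥ T` with `W T e^{-a (T₂ - T)} < ε / 2`
  have hexp : Tendsto (fun s : ℝ => W T * Real.exp (-a * s)) atTop (𝓝 0) := by
    have h1 : Tendsto (fun s : ℝ => Real.exp (-a * s)) atTop (𝓝 0) := by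
      have := Real.tendsto_exp_neg_atTop_nhds_zero.comp (tendsto_id.const_mul_atTop ha)
      refine this.congr fun s => ?_
      simp [neg_mul]
    simpa using h1.const_mul (W T)
  obtain ⟨S₀, hS₀⟩ := (Metric.tendsto_atTop.1 hexp) (ε / 2) (half_pos hε)
  refine ⟨T + max S₀ 0, fun t ht => ?_⟩
  have hS : max S₀ 0 ≤ t - T := by linarith
  have htT : T ≤ t := by linarith [le_max_right S₀ 0]
  have ht₀ : T₀ ≤ t := hTT₀.trans htT
  have h1 := hgron t t ⟨htT, le_rfl⟩
  have h2 := hgb (t - T) (by linarith)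
  have h3 := hS₀ (t - T) ((le_max_left _ _).trans hS)
  rw [Real.dist_eq, sub_zero] at h3
  have h4 : W T * Real.exp (-a * (t - T)) < ε / 2 := (le_abs_self _).trans_lt h3
  rw [Real.dist_eq, sub_zero, abs_of_nonneg (hW t ht₀)]
  linarith

/-- **Asymptotics of the forced damped rotation.** If `A`, `B` are differentiable within
`[T₀, ∞)` with `A' = e₁ - aA - ωB + c`, `B' = e₂ + ωA - aB` there, `a > 0`, and the errors
`e₁, e₂ → 0`, then `A → c a/(a² + ω²)` and `B → c ω/(a² + ω²)` (the unique rest point): the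
Lyapunov function `W = (A - A_∞)² + (B - B_∞)²` has `W' = -2aW + 2(A - A_∞)e₁ + 2(B - B_∞)e₂
≤ -aW + (2/a)(e₁² + e₂²)`. [folklore] -/
theorem tendsto_of_damped_rotation {A B A' B' e₁ e₂ : ℝ → ℝ} {a ω c T₀ : ℝ} (ha : 0 < a)
    (hA : ∀ t, T₀ ≤ t → HasDerivWithinAt A (A' t) (Ici T₀) t)
    (hB : ∀ t, T₀ ≤ t → HasDerivWithinAt B (B' t) (Ici T₀) t)
    (hA' : ∀ t, T₀ ≤ t → A' t = e₁ t - a * A t - ω * B t + c)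
    (hB' : ∀ t, T₀ ≤ t → B' t = e₂ t + ω * A t - a * B t)
    (he₁ : Tendsto e₁ atTop (𝓝 0)) (he₂ : Tendsto e₂ atTop (𝓝 0)) :
    Tendsto A atTop (𝓝 (c * a / (a ^ 2 + ω ^ 2))) ∧
      Tendsto B atTop (𝓝 (c * ω / (a ^ 2 + ω ^ 2))) := by
  set A₀ : ℝ := c * a / (a ^ 2 + ω ^ 2) with hA₀
  set B₀ : ℝ := c * ω / (a ^ 2 + ω ^ 2) with hB₀
  have hD : 0 < a ^ 2 + ω ^ 2 := by positivity
  have hfixA : c - a * A₀ - ω * B₀ = 0 := by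
    rw [hA₀, hB₀]
    field_simp
    ring
  have hfixB : ω * A₀ - a * B₀ = 0 := by
    rw [hA₀, hB₀]
    field_simp
    ring
  -- the Lyapunov function and its derivative
  set W : ℝ → ℝ := fun t => (A t - A₀) * (A t - A₀) + (B t - B₀) * (B t - B₀) with hW
  set W' : ℝ → ℝ := fun t =>
    -2 * a * W t + 2 * ((A t - A₀) * e₁ t) + 2 * ((B t - B₀) * e₂ t) with hW'
  have hWd : ∀ t, T₀ ≤ t → HasDerivWithinAt W (W' t) (Ici T₀) t := by
    intro t ht
    have h1 := (hA t ht).sub_const A₀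
    have h2 := (hB t ht).sub_const B₀
    have h := (h1.mul h1).add (h2.mul h2)
    refine h.congr_deriv ?_
    simp only [hW', hW, hA' t ht, hB' t ht]
    linear_combination (2 * (A t - A₀)) * hfixA + (2 * (B t - B₀)) * hfixB
  have hWnn : ∀ t, T₀ ≤ t → 0 ≤ W t := fun t _ => by
    simp only [hW]
    nlinarith [mul_self_nonneg (A t - A₀), mul_self_nonneg (B t - B₀)]
  -- `W' ≤ -a W + (2/a)(e₁² + e₂²)`
  set g : ℝ → ℝ := fun t => 2 / a * (e₁ t * e₁ t + e₂ t * e₂ t) with hg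
  have hbound : ∀ t, T₀ ≤ t → W' t ≤ -a * W t + g t := by
    intro t _
    simp only [hW', hW, hg]
    have h1 : 2 * ((A t - A₀) * e₁ t) ≤ a / 2 * ((A t - A₀) * (A t - A₀)) + 2 / a * (e₁ t * e₁ t) := by
      have := mul_self_nonneg (a * (A t - A₀) - 2 * e₁ t)
      have ha2 : 0 < 2 * a := by positivity
      rw [← sub_nonneg]
      have key : a / 2 * ((A t - A₀) * (A t - A₀)) + 2 / a * (e₁ t * e₁ t) - 2 * ((A t - A₀) * e₁ t)
          = (a * (A t - A₀) - 2 * e₁ t) * (a * (A t - A₀) - 2 * e₁ t) / (2 * a) := by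
        field_simp
        ring
      rw [key]
      exact div_nonneg (mul_self_nonneg _) (by positivity)
    have h2 : 2 * ((B t - B₀) * e₂ t) ≤ a / 2 * ((B t - B₀) * (B t - B₀)) + 2 / a * (e₂ t * e₂ t) := by
      rw [← sub_nonneg]
      have key : a / 2 * ((B t - B₀) * (B t - B₀)) + 2 / a * (e₂ t * e₂ t) - 2 * ((B t - B₀) * e₂ t)
          = (a * (B t - B₀) - 2 * e₂ t) * (a * (B t - B₀) - 2 * e₂ t) / (2 * a) := by
        field_simp
        ring
      rw [key]
      exact div_nonneg (mul_self_nonneg _) (by positivity)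
    nlinarith [mul_self_nonneg (A t - A₀), mul_self_nonneg (B t - B₀)]
  have hg0 : Tendsto g atTop (𝓝 0) := by
    have h := ((he₁.mul he₁).add (he₂.mul he₂)).const_mul (2 / a)
    simpa [hg] using h
  have hW0 : Tendsto W atTop (𝓝 0) :=
    tendsto_zero_of_deriv_le_neg_mul_add ha hWd hbound hWnn hg0
  -- each square is dominated by `W`
  have hsqA : Tendsto (fun t => (A t - A₀) * (A t - A₀)) atTop (𝓝 0) := by
    refine squeeze_zero' (Eventually.of_forall fun t => mul_self_nonneg _) ?_ hW0
    filter_upwards with t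
    simp only [hW]
    nlinarith [mul_self_nonneg (B t - B₀)]
  have hsqB : Tendsto (fun t => (B t - B₀) * (B t - B₀)) atTop (𝓝 0) := by
    refine squeeze_zero' (Eventually.of_forall fun t => mul_self_nonneg _) ?_ hW0
    filter_upwards with t
    simp only [hW]
    nlinarith [mul_self_nonneg (A t - A₀)]
  have habsA : Tendsto (fun t => |A t - A₀|) atTop (𝓝 0) := by
    have h := hsqA.sqrt
    rw [Real.sqrt_zero] at h
    refine h.congr fun t => ?_
    exact Real.sqrt_mul_self_eq_abs _
  have habsB : Tendsto (fun t => |B t - B₀|) atTop (𝓝 0) := by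
    have h := hsqB.sqrt
    rw [Real.sqrt_zero] at h
    refine h.congr fun t => ?_
    exact Real.sqrt_mul_self_eq_abs _
  constructor
  · have h := (tendsto_zero_iff_abs_tendsto_zero _).2 habsA
    have h2 := h.add_const A₀
    simpa using h2
  · have h := (tendsto_zero_iff_abs_tendsto_zero _).2 habsB
    have h2 := h.add_const B₀
    simpa using h2

end LongitudinalQuiet

end Summit.AnomalousDissipation.AnomalousDissipation.Theorems

end
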